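import Mathlib
import HarnessLib
import Summits.HubbardSuperconductivity.HubbardSuperconductivity.Theorems.KLProgrammeKLRegimeSplitThermalLayer

/-!
# Route `KLProgramme` — edge facts for the pair masses ACROSS TRANSFERS, XIX: the CUMULATIVE FLOOR (D3′) BY SHAPE from per-step floors with exceptional scales —
# `b ≤ W₀(j)` off an exceptional set of `≤ s` scales, `0 ≤ W₀` everywhere ⟹ `b·n − b·s ≤ Σ_{j<n} W₀(j)`

Cell gate-hubbard-kl, seat hubbard-kl-k3c1-p1 (g21; child-1 lineage).  Row 17 (`sWaveCascade.…_of_cumulativeFloor`) consumes S2-ROWS (D3′) in the form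
`b_lo·n − s₀ ≤ Σ_{j<n} W₀(j)`; row 32 (`klpw_pinned_mass_floor_of_windows`) gives the PER-STEP floor `b_lo ≤ W₀(j)` at every scale whose Matsubara window is nonempty
(`(2k − 1)π/β ≤ Λ_j/√8` with `k ≥ 1`) and whose grid resolves the shell — all but `O(1)` scales; the pinned masses are nonnegative everywhere (row 15
`klTransferWeight_pin_nonpos`).  THIS FILE is the bookkeeping between the two: **`klcf_cumulative_floor`** — if `0 ≤ W₀(j)` for all `j`, `b ≤ W₀(j)` for `j < n` outside an
exceptional finset `E` with `#E ≤ s`, and `0 ≤ b`, then `b·n − b·s ≤ Σ_{j<n} W₀(j)` (so `s₀ = b_lo·s`).  Pure arithmetic; no definitions; nothing asserts any slot, stub, K3 or SC. [folklore]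
-/

noncomputable section

namespace Summit.HubbardSuperconductivity.HubbardSuperconductivity.Theorems.KLRegimeSplit

set_option linter.dupNamespace false -- summit = problem name (single-conjunct summit), D-0017

open Real Finset

/-- **Cumulative floor from per-step floors with exceptions**: `0 ≤ W j` (all `j`), `b ≤ W j` for `j < n`, `j ∉ E`, `#E ≤ s`, `0 ≤ b` ⟹ `b·n − b·s ≤ Σ_{j<n} W j`. [folklore] -/
theorem klcf_cumulative_floor (W : ℕ → ℝ) (hW0 : ∀ j, 0 ≤ W j) {b : ℝ} (hb : 0 ≤ b) (E : Finset ℕ) {s : ℕ} (hE : E.card ≤ s) (n : ℕ)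
    (hfloor : ∀ j, j < n → j ∉ E → b ≤ W j) :
    b * n - b * s ≤ ∑ j ∈ range n, W j := by
  classical
  -- split `range n` into the good scales and the exceptional ones
  have hsplit := (sum_filter_add_sum_filter_not (range n) (fun j => j ∈ E) W)
  have hgood : b * (((range n).filter fun j => j ∉ E).card : ℝ) ≤ ∑ j ∈ (range n).filter (fun j => j ∉ E), W j := by
    have := Finset.card_nsmul_le_sum ((range n).filter fun j => j ∉ E) W b fun j hj => by
      rw [mem_filter, mem_range] at hj
      exact hfloor j hj.1 hj.2
    rw [nsmul_eq_mul] at this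
    linarith
  have hbad : 0 ≤ ∑ j ∈ (range n).filter (fun j => j ∈ E), W j := sum_nonneg fun j _ => hW0 j
  -- the good scales are at least `n − s`
  have hcardN : n ≤ ((range n).filter fun j => j ∉ E).card + s := by
    have h1 : ((range n).filter fun j => j ∈ E).card ≤ E.card :=
      Finset.card_le_card fun j hj => (mem_filter.1 hj).2
    have h2 := Finset.card_filter_add_card_filter_not (s := range n) (fun j => j ∈ E)
    rw [card_range] at h2
    omega
  have hcard : (n : ℝ) - s ≤ (((range n).filter fun j => j ∉ E).card : ℝ) := by
    have : (n : ℝ) ≤ (((range n).filter fun j => j ∉ E).card : ℝ) + s := by exact_mod_cast hcardN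
    linarith
  rw [← hsplit]
  nlinarith

/-- **The (D3′) shape**: with `s₀ := b·s`, the conclusion reads `b·n − s₀ ≤ Σ_{j<n} W j` for every `n` (the hypothesis of row 17's cumulative-floor closer, given the floor
off `E` at every `j`). [folklore] -/
theorem klcf_cumulative_floor_all (W : ℕ → ℝ) (hW0 : ∀ j, 0 ≤ W j) {b : ℝ} (hb : 0 ≤ b) (E : Finset ℕ) {s : ℕ} (hE : E.card ≤ s)
    (hfloor : ∀ j, j ∉ E → b ≤ W j) : ∀ n : ℕ, b * n - b * s ≤ ∑ j ∈ range n, W j :=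
  fun n => klcf_cumulative_floor W hW0 hb E hE n fun j _ hj => hfloor j hj

end Summit.HubbardSuperconductivity.HubbardSuperconductivity.Theorems.KLRegimeSplit

end
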